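import Mathlib

/-!
# Stub `stub_uniformCone` (crux `AhHadamardFilling`, line `einstein-bulk-transfer`)

Uniform cone estimate for a fibrewise quadratic function `Q` on the tangent bundle of `M × ℝ`
over a closed Riemannian `4`-manifold `(M, g₀)`: if `Q` restricted to positive heights is
continuous at every tangent vector over the zero slice `M × 0`, where it equals
`s² + g₀(v, v)`, then `|Q_{(x,λ)}(v,s) - (s² + g₀(v,v))| ≤ ε (s² + g₀(v,v))` for `0 < λ < t(ε)`.
The proof is the compactness of the `g₀ ⊕ dλ²`-short vectors over `M × [0, 1]` (adapted from the
tree's `PseudoRiemannianMetric.exists_isCompact_tangent_superset`, Lee 2018, proof of Lemma 6.19)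
and a cluster-point argument.
-/

noncomputable section

set_option linter.dupNamespace false

open scoped Manifold ContDiff Topology
open Set Function Bundle Filter

namespace Summit.SmoothPoincare4.SmoothPoincare4.Cruxes.AhHadamardFilling.EinsteinBulkTransfer

section General

variable {E : Type*} [NormedAddCommGroup E] [NormedSpace ℝ E] {H : Type*} [TopologicalSpace H]
  {I : ModelWithCorners ℝ E H} {M : Type*} [TopologicalSpace M] [ChartedSpace H M]
  [IsManifold I ∞ M]

-- adapted from `Literature.Geometry.Lorentzian.PseudoRiemannianMetric.continuous_val_tangentBundle`
/-- Continuity on the tangent bundle of the quadratic function `p ↦ g_{π p}(p, p)` of a `C^n`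
Riemannian metric `g` (the metric is a `C^n` section of the bundle of bilinear forms; evaluate it
twice on the identity section over the projection, `ContMDiff.clm_bundle_apply₂`). [folklore] -/
private theorem continuous_inner_tangentBundle {n : ℕ∞ω}
    (g : ContMDiffRiemannianMetric I n E (TangentSpace I : M → Type _)) :
    Continuous fun p : TangentBundle I M ↦ g.inner p.proj p.2 p.2 := by
  have hψ : ContMDiff I.tangent (I.prod 𝓘(ℝ, E →L[ℝ] E →L[ℝ] ℝ)) n
      (fun p : TangentBundle I M ↦ TotalSpace.mk' (E →L[ℝ] E →L[ℝ] ℝ)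
        (E := fun x : M ↦ TangentSpace I x →L[ℝ] TangentSpace I x →L[ℝ] ℝ)
        p.proj (g.inner p.proj)) :=
    g.contMDiff.comp (Bundle.contMDiff_proj (TangentSpace I : M → Type _))
  have hv : ContMDiff I.tangent I.tangent n
      (fun p : TangentBundle I M ↦ (TotalSpace.mk' E p.proj p.2 : TangentBundle I M)) :=
    contMDiff_id
  have h2 : ContMDiff I.tangent (I.prod 𝓘(ℝ, ℝ)) n
      (fun p : TangentBundle I M ↦
        TotalSpace.mk' ℝ (E := Bundle.Trivial M ℝ) p.proj (g.inner p.proj p.2 p.2)) :=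
    hψ.clm_bundle_apply₂ (F₁ := E) (F₂ := E) hv hv
  exact ((Bundle.Trivial.homeomorphProd M ℝ).continuous.comp h2.continuous).snd

-- adapted from
-- `Literature.Geometry.Lorentzian.PseudoRiemannianMetric.exists_isCompact_tangent_superset`
/-- **Compactness of the set of short vectors over a compact set.** For a continuous function
`f` on the tangent bundle which is fibrewise `2`-homogeneous and positive on non-zero vectors, a
compact `K ⊆ M` and `C : ℝ`, there is a compact `𝒦 ⊆ TM` containing every `p` with `π p ∈ K` and
`f p ≤ C`: over a compact neighbourhood `N` inside a trivialising chart `e`, the continuous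
function `(y, w) ↦ f (e⁻¹ (y, w))` has a positive minimum `m` on `N × {‖w‖ = 1}`, so `f p ≤ C`
forces `‖e p‖² ≤ C / m`; finitely many such `N` cover `K` (Lee 2018, proof of Lemma 6.19).
[folklore] -/
private theorem exists_isCompact_superset_of_le [LocallyCompactSpace M] [FiniteDimensional ℝ E]
    {f : TangentBundle I M → ℝ} (hF : Continuous f)
    (hsmul : ∀ (x : M) (v : TangentSpace I x) (c : ℝ),
      f (TotalSpace.mk' E x (c • v)) = c ^ 2 * f (TotalSpace.mk' E x v))
    (hpos : ∀ (x : M) (v : TangentSpace I x), v ≠ 0 → 0 < f (TotalSpace.mk' E x v))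
    {K : Set M} (hK : IsCompact K) (C : ℝ) :
    ∃ 𝒦 : Set (TangentBundle I M), IsCompact 𝒦 ∧
      ∀ p : TangentBundle I M, p.proj ∈ K → f p ≤ C → p ∈ 𝒦 := by
  classical
  -- `f` vanishes on the zero section and is non-negative
  have hzero : ∀ x : M, f (TotalSpace.mk' E x 0) = 0 := by
    intro x
    have h := hsmul x 0 0
    rw [smul_zero] at h
    simpa using h
  have hnn : ∀ p : TangentBundle I M, 0 ≤ f p := by
    rintro ⟨x, v⟩
    by_cases hv : v = 0
    · rw [hv]
      exact (hzero x).ge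
    · exact (hpos x v hv).le
  -- the local statement near each point
  have hloc : ∀ x : M, ∃ N ∈ 𝓝 x, ∃ 𝒦 : Set (TangentBundle I M), IsCompact 𝒦 ∧
      ∀ p : TangentBundle I M, p.proj ∈ N → f p ≤ C → p ∈ 𝒦 := by
    intro x
    set e := trivializationAt E (TangentSpace I : M → Type _) x with he_def
    have hxe : x ∈ e.baseSet := FiberBundle.mem_baseSet_trivializationAt' x
    obtain ⟨N, hN, hNe, hNc⟩ := local_compact_nhds (e.open_baseSet.mem_nhds hxe)
    -- the function in the chart `e`
    set Φ : M × E → ℝ := fun yw ↦ f (TotalSpace.mk' E yw.1 (e.symm yw.1 yw.2)) with hΦ_def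
    have hΦc : ContinuousOn Φ (e.baseSet ×ˢ univ) := hF.comp_continuousOn e.continuousOn_symm
    have hΦsmul : ∀ y ∈ e.baseSet, ∀ (c : ℝ) (w : E), Φ (y, c • w) = c ^ 2 * Φ (y, w) := by
      intro y hy c w
      simp only [hΦ_def]
      rw [← e.symmL_apply (R := ℝ) hy, ← e.symmL_apply (R := ℝ) hy, map_smul]
      exact hsmul y _ c
    -- a positive lower bound on `N × sphere`
    obtain ⟨m, hm, hmΦ⟩ : ∃ m : ℝ, 0 < m ∧ ∀ yw ∈ N ×ˢ Metric.sphere (0 : E) 1, m ≤ Φ yw := by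
      by_cases hne : (N ×ˢ Metric.sphere (0 : E) 1).Nonempty
      · have hc : IsCompact (N ×ˢ Metric.sphere (0 : E) 1) := hNc.prod (isCompact_sphere 0 1)
        obtain ⟨yw₀, hyw₀, hmin⟩ :=
          hc.exists_isMinOn hne (hΦc.mono (prod_mono hNe (subset_univ _)))
        refine ⟨Φ yw₀, ?_, fun yw hyw ↦ hmin hyw⟩
        have hy₀ : yw₀.1 ∈ e.baseSet := hNe hyw₀.1
        have hw₀ : e.symm yw₀.1 yw₀.2 ≠ 0 := by
          intro h0
          have h2 : e.symmL ℝ yw₀.1 yw₀.2 = 0 := by rwa [e.symmL_apply (R := ℝ) hy₀]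
          have h3 := congrArg (e.continuousLinearMapAt ℝ yw₀.1) h2
          rw [e.continuousLinearMapAt_symmL hy₀, map_zero] at h3
          have h4 : ‖yw₀.2‖ = 1 := by simpa using hyw₀.2
          rw [h3, norm_zero] at h4
          exact zero_ne_one h4
        exact hpos _ _ hw₀
      · exact ⟨1, one_pos, fun yw hyw ↦ (hne ⟨yw, hyw⟩).elim⟩
    -- the chart norm of an `f`-short vector over `N` is bounded
    have hbd : ∀ p : TangentBundle I M, p.proj ∈ N → f p ≤ C → ‖(e p).2‖ ^ 2 ≤ C / m := by
      intro p hp hC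
      have hpe : p.proj ∈ e.baseSet := hNe hp
      have hC0 : 0 ≤ C := (hnn p).trans hC
      set w : E := (e p).2 with hw_def
      by_cases hw0 : w = 0
      · rw [hw0, norm_zero, zero_pow two_ne_zero]
        positivity
      · have hsym : e.symm p.proj w = p.2 := e.symm_proj_apply p hpe
        have hwpos : 0 < ‖w‖ := norm_pos_iff.2 hw0
        set u : E := ‖w‖⁻¹ • w with hu_def
        have hu : u ∈ Metric.sphere (0 : E) 1 := by
          rw [mem_sphere_zero_iff_norm, hu_def, norm_smul, norm_inv, norm_norm,
            inv_mul_cancel₀ hwpos.ne']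
        have h1 : m ≤ Φ (p.proj, u) := hmΦ _ ⟨hp, hu⟩
        have h2 : Φ (p.proj, u) = ‖w‖⁻¹ ^ 2 * Φ (p.proj, w) := hΦsmul _ hpe _ _
        have h3 : Φ (p.proj, w) = f p := by
          simp only [hΦ_def, hsym]
        rw [h2, h3] at h1
        have h4 : m * ‖w‖ ^ 2 ≤ C := by
          have h5 := mul_le_mul_of_nonneg_right h1 (sq_nonneg ‖w‖)
          calc m * ‖w‖ ^ 2 ≤ ‖w‖⁻¹ ^ 2 * f p * ‖w‖ ^ 2 := h5
            _ = f p := by field_simp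
            _ ≤ C := hC
        rw [le_div_iff₀ hm]
        linarith
    -- the compact set `e⁻¹ (N × closedBall)`
    refine ⟨N, hN, (fun yw : M × E ↦ (TotalSpace.mk' E yw.1 (e.symm yw.1 yw.2) :
      TangentBundle I M)) '' (N ×ˢ Metric.closedBall (0 : E) (Real.sqrt (C / m))), ?_, ?_⟩
    · exact (hNc.prod (isCompact_closedBall 0 _)).image_of_continuousOn
        (e.continuousOn_symm.mono (prod_mono hNe (subset_univ _)))
    · intro p hp hC
      have hpe : p.proj ∈ e.baseSet := hNe hp
      have hps : p ∈ e.source := e.mem_source.2 hpe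
      refine ⟨e p, ⟨?_, ?_⟩, ?_⟩
      · rw [e.coe_fst hps]
        exact hp
      · rw [Metric.mem_closedBall, dist_zero_right]
        calc ‖(e p).2‖ = Real.sqrt (‖(e p).2‖ ^ 2) := (Real.sqrt_sq (norm_nonneg _)).symm
          _ ≤ Real.sqrt (C / m) := Real.sqrt_le_sqrt (hbd p hp hC)
      · have hb : (e p).1 ∈ e.baseSet := by
          rw [e.coe_fst hps]
          exact hpe
        show TotalSpace.mk (e p).1 (e.symm (e p).1 (e p).2) = p
        rw [e.mk_symm hb, Prod.mk.eta]
        exact e.toOpenPartialHomeomorph.left_inv hps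
  -- cover `K` by finitely many such neighbourhoods
  choose N hN 𝒦 h𝒦 hmem using hloc
  obtain ⟨t, -, ht⟩ := hK.elim_nhds_subcover N fun x _ ↦ hN x
  refine ⟨⋃ x ∈ t, 𝒦 x, t.isCompact_biUnion fun x _ ↦ h𝒦 x, fun p hp hC ↦ ?_⟩
  obtain ⟨x, hx, hpx⟩ := mem_iUnion₂.1 (ht hp)
  exact mem_iUnion₂.2 ⟨x, hx, hmem x p hpx hC⟩

end General

/-- **Uniform cone estimate.** Let `M` be closed with a smooth Riemannian metric `g₀` and let
`Q_p(w)` be a fibrewise degree-2-homogeneous function on `T(M × ℝ)` which, restricted to positive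
heights, is continuous at every vector over the zero slice `M × 0`, where it equals
`s² + g₀(v,v)`. Then `|Q_{(x,λ)}(v,s) - (s² + g₀(v,v))| ≤ ε (s² + g₀(v,v))` for `0 < λ < t(ε)`
(compactness of the `g₀ ⊕ dλ²`-short vectors over `M × [0, 1]`, a cluster point of a sequence
of bad unit vectors with heights `λₙ → 0⁺`, and homogeneity). [folklore] -/
theorem stub_uniformCone
    (M : Type) [TopologicalSpace M] [T2Space M] [SecondCountableTopology M]
    [ChartedSpace (EuclideanSpace ℝ (Fin 4)) M] [IsManifold (𝓡 4) ∞ M] [CompactSpace M]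
    (g₀ : Bundle.ContMDiffRiemannianMetric (𝓡 4) ∞ (EuclideanSpace ℝ (Fin 4))
      (TangentSpace (𝓡 4) : M → Type _))
    (Q : (p : M × ℝ) → TangentSpace ((𝓡 4).prod 𝓘(ℝ, ℝ)) p → ℝ)
    (hhom : ∀ (p : M × ℝ) (w : TangentSpace ((𝓡 4).prod 𝓘(ℝ, ℝ)) p) (a : ℝ),
      Q p (a • w) = a ^ 2 * Q p w)
    (hcont : ∀ (x : M) (w : TangentSpace ((𝓡 4).prod 𝓘(ℝ, ℝ)) (x, (0 : ℝ))),
      ContinuousWithinAt (fun q : TangentBundle ((𝓡 4).prod 𝓘(ℝ, ℝ)) (M × ℝ) => Q q.proj q.snd)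
        {q | 0 < q.proj.2} ⟨(x, 0), w⟩)
    (h0 : ∀ (x : M) (v : TangentSpace (𝓡 4) x) (s : ℝ), Q (x, 0) (v, s) = s ^ 2 + g₀.inner x v v) :
    ∀ ε : ℝ, 0 < ε → ∃ t : ℝ, 0 < t ∧ ∀ (x : M) (l : ℝ), l ∈ Ioo (0 : ℝ) t →
      ∀ (v : TangentSpace (𝓡 4) x) (s : ℝ),
        |Q (x, l) (v, s) - (s ^ 2 + g₀.inner x v v)| ≤ ε * (s ^ 2 + g₀.inner x v v) := by
  intro ε hε
  -- the model quadratic form `qf x (v, s) = s² + g₀(v, v)` and the function `f` on `T(M × ℝ)`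
  let qf : (x : M) → TangentSpace (𝓡 4) x × ℝ → ℝ := fun x w ↦ w.2 ^ 2 + g₀.inner x w.1 w.1
  let f : TangentBundle ((𝓡 4).prod 𝓘(ℝ, ℝ)) (M × ℝ) → ℝ := fun q ↦ qf q.proj.1 q.snd
  have hinn : ∀ (x : M) (v : TangentSpace (𝓡 4) x), 0 ≤ g₀.inner x v v := by
    intro x v
    by_cases hv : v = 0
    · rw [hv]
      simp
    · exact (g₀.pos x v hv).le
  have hinn_smul : ∀ (x : M) (v : TangentSpace (𝓡 4) x) (c : ℝ),
      g₀.inner x (c • v) (c • v) = c ^ 2 * g₀.inner x v v := by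
    intro x v c
    rw [map_smul, map_smul]
    simp only [FunLike.coe_smul, Pi.smul_apply, smul_eq_mul]
    ring
  have hqf_smul : ∀ (x : M) (w : TangentSpace (𝓡 4) x × ℝ) (c : ℝ),
      qf x (c • w) = c ^ 2 * qf x w := by
    intro x w c
    simp only [qf, Prod.smul_snd, Prod.smul_fst, hinn_smul, smul_eq_mul]
    ring
  have hqf_pos : ∀ (x : M) (w : TangentSpace (𝓡 4) x × ℝ), w ≠ 0 → 0 < qf x w := by
    intro x w hw
    simp only [qf]
    by_cases h1 : w.1 = 0
    · have h2 : w.2 ≠ 0 := fun h2 ↦ hw (Prod.ext h1 h2)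
      have : 0 < w.2 ^ 2 := by positivity
      linarith [hinn x w.1]
    · have := g₀.pos x w.1 h1
      linarith [sq_nonneg w.2]
  have hfc : Continuous f := by
    have h1 : Continuous fun q : TangentBundle ((𝓡 4).prod 𝓘(ℝ, ℝ)) (M × ℝ) ↦
        g₀.inner q.proj.1 q.snd.1 q.snd.1 := by
      have h := (continuous_inner_tangentBundle g₀).comp
        ((contMDiff_fst (I := 𝓡 4) (J := 𝓘(ℝ, ℝ)) (M := M) (N := ℝ) (n := 1)).continuous_tangentMap
          le_rfl)
      refine h.congr fun q ↦ ?_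
      rw [Function.comp_apply, tangentMap_prodFst]
    have h2 : Continuous fun q : TangentBundle ((𝓡 4).prod 𝓘(ℝ, ℝ)) (M × ℝ) ↦ q.snd.2 := by
      have h := (contMDiff_snd_tangentBundle_modelSpace ℝ 𝓘(ℝ, ℝ) (n := 0)).continuous.comp
        ((contMDiff_snd (I := 𝓡 4) (J := 𝓘(ℝ, ℝ)) (M := M) (N := ℝ) (n := 1)).continuous_tangentMap
          le_rfl)
      refine h.congr fun q ↦ ?_
      rw [Function.comp_apply, tangentMap_prodSnd]
    exact (h2.pow 2).add h1
  have hfsmul : ∀ (p : M × ℝ) (w : TangentSpace ((𝓡 4).prod 𝓘(ℝ, ℝ)) p) (c : ℝ),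
      f (TotalSpace.mk' (EuclideanSpace ℝ (Fin 4) × ℝ) p (c • w)) =
        c ^ 2 * f (TotalSpace.mk' (EuclideanSpace ℝ (Fin 4) × ℝ) p w) :=
    fun p w c ↦ hqf_smul p.1 w c
  have hfpos : ∀ (p : M × ℝ) (w : TangentSpace ((𝓡 4).prod 𝓘(ℝ, ℝ)) p), w ≠ 0 →
      0 < f (TotalSpace.mk' (EuclideanSpace ℝ (Fin 4) × ℝ) p w) :=
    fun p w hw ↦ hqf_pos p.1 w hw
  -- Step 1: the estimate for `f`-unit vectors, by compactness and a cluster point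
  have hunit : ∃ t : ℝ, 0 < t ∧ ∀ q : TangentBundle ((𝓡 4).prod 𝓘(ℝ, ℝ)) (M × ℝ),
      q.proj.2 ∈ Ioo (0 : ℝ) t → f q = 1 → |Q q.proj q.snd - 1| ≤ ε := by
    by_contra H
    push Not at H
    choose P hPl hPf hPε using fun n : ℕ ↦ H (1 / ((n : ℝ) + 1)) Nat.one_div_pos_of_nat
    haveI : LocallyCompactSpace M := inferInstance
    obtain ⟨𝒦, h𝒦, h𝒦mem⟩ := exists_isCompact_superset_of_le (I := (𝓡 4).prod 𝓘(ℝ, ℝ))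
      (M := M × ℝ) hfc hfsmul hfpos ((isCompact_univ (X := M)).prod (isCompact_Icc (a := (0 : ℝ))
        (b := 1))) 1
    have hPmem : ∀ n, P n ∈ 𝒦 := by
      intro n
      refine h𝒦mem (P n) ⟨mem_univ _, (hPl n).1.le, (hPl n).2.le.trans ?_⟩ (hPf n).le
      rw [div_le_one (by positivity)]
      linarith [(n.cast_nonneg : (0 : ℝ) ≤ n)]
    obtain ⟨P₀, -, hmc⟩ := h𝒦.exists_mapClusterPt_of_frequently (l := atTop)
      (Frequently.of_forall hPmem)
    -- `f P₀ = 1`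
    have hfP₀ : f P₀ = 1 := by
      have h1 : MapClusterPt (f P₀) atTop (f ∘ P) := hmc.continuousAt_comp hfc.continuousAt
      have h2 : Tendsto (f ∘ P) atTop (𝓝 1) :=
        (tendsto_congr fun n ↦ (hPf n)).2 tendsto_const_nhds
      exact eq_of_nhds_neBot (h1.clusterPt.mono h2)
    -- the height of `P₀` vanishes
    have hl0 : P₀.proj.2 = 0 := by
      have hπ : Continuous fun q : TangentBundle ((𝓡 4).prod 𝓘(ℝ, ℝ)) (M × ℝ) ↦ q.proj.2 :=
        continuous_snd.comp (FiberBundle.continuous_proj (EuclideanSpace ℝ (Fin 4) × ℝ)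
          (TangentSpace ((𝓡 4).prod 𝓘(ℝ, ℝ)) : M × ℝ → Type _))
      have h1 : MapClusterPt P₀.proj.2 atTop
          ((fun q : TangentBundle ((𝓡 4).prod 𝓘(ℝ, ℝ)) (M × ℝ) ↦ q.proj.2) ∘ P) :=
        MapClusterPt.continuousAt_comp
          (f := fun q : TangentBundle ((𝓡 4).prod 𝓘(ℝ, ℝ)) (M × ℝ) ↦ q.proj.2) hπ.continuousAt hmc
      have h2 : Tendsto ((fun q : TangentBundle ((𝓡 4).prod 𝓘(ℝ, ℝ)) (M × ℝ) ↦ q.proj.2) ∘ P)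
          atTop (𝓝 0) :=
        squeeze_zero (fun n ↦ (hPl n).1.le) (fun n ↦ (hPl n).2.le)
          tendsto_one_div_add_atTop_nhds_zero_nat
      exact eq_of_nhds_neBot (h1.clusterPt.mono h2)
    obtain ⟨⟨x, l⟩, w⟩ := P₀
    change l = 0 at hl0
    subst hl0
    -- continuity of `Q` from positive heights at the cluster point
    have hQ0 : Q (x, 0) w = 1 := (h0 x w.1 w.2).trans hfP₀
    have hV := (hcont x w).preimage_mem_nhdsWithin (Metric.ball_mem_nhds (Q (x, 0) w) hε)
    obtain ⟨V, hV, hVS⟩ := mem_nhdsWithin_iff_exists_mem_nhds_inter.1 hV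
    obtain ⟨n, hn⟩ := ((mapClusterPt_iff_frequently.1 hmc) V hV).exists
    have hlt : |Q (P n).proj (P n).snd - 1| < ε := by
      have h := hVS ⟨hn, (hPl n).1⟩
      rw [mem_preimage, Metric.mem_ball, Real.dist_eq, hQ0] at h
      exact h
    exact absurd hlt (not_lt.2 (hPε n).le)
  -- Step 2: homogeneity
  obtain ⟨t, ht, hunit⟩ := hunit
  refine ⟨t, ht, fun x l hl v s ↦ ?_⟩
  have hq0 : 0 ≤ s ^ 2 + g₀.inner x v v := by linarith [sq_nonneg s, hinn x v]
  rcases hq0.lt_or_eq with hq | hq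
  · -- normalise to an `f`-unit vector
    set q : ℝ := s ^ 2 + g₀.inner x v v with hq_def
    let w : TangentSpace ((𝓡 4).prod 𝓘(ℝ, ℝ)) (x, l) := (v, s)
    set r : ℝ := Real.sqrt q with hr_def
    have hr : 0 < r := Real.sqrt_pos.2 hq
    have hrq : r ^ 2 = q := Real.sq_sqrt hq.le
    have hfw : f (TotalSpace.mk' (EuclideanSpace ℝ (Fin 4) × ℝ) (x, l) w) = q := rfl
    have hunit' := hunit (TotalSpace.mk' (EuclideanSpace ℝ (Fin 4) × ℝ) (x, l) (r⁻¹ • w)) hl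
      (by rw [hfsmul, hfw, inv_pow, hrq, inv_mul_cancel₀ hq.ne'])
    have hQ : Q (x, l) (r⁻¹ • w) = q⁻¹ * Q (x, l) w := by rw [hhom, inv_pow, hrq]
    change |Q (x, l) (r⁻¹ • w) - 1| ≤ ε at hunit'
    rw [hQ] at hunit'
    have h1 : Q (x, l) w - q = q * (q⁻¹ * Q (x, l) w - 1) := by field_simp
    show |Q (x, l) w - q| ≤ ε * q
    rw [h1, abs_mul, abs_of_pos hq, mul_comm]
    exact mul_le_mul_of_nonneg_right hunit' hq.le
  · -- the zero vector
    have hs : s = 0 := by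
      by_contra hs
      have : 0 < s ^ 2 := by positivity
      linarith [hinn x v]
    have hv : v = 0 := by
      by_contra hv
      have := g₀.pos x v hv
      linarith [sq_nonneg s]
    have hQ : Q (x, l) (v, s) = 0 := by
      have h := hhom (x, l) (v, s) 0
      rw [zero_pow two_ne_zero, zero_mul, zero_smul] at h
      rw [hv, hs]
      exact h
    rw [hQ, ← hq]
    simp
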